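import Literature.Computability.QuantumComplexity.RevMultiplex
import Literature.Computability.QuantumComplexity.RevUncompute
import HarnessLib

/-!
# Classical gadgets for wrapping a quantum subroutine: fan-in XOR layers and the controlled pair-format copy

Reversible `NOT`/`CNOT`/Toffoli gadgets (`RevGadgets.ClOp` programs over an arbitrary wire
type `ι`) used around a quantum subroutine by the classical-wrap construction (deterministic
polynomial-time pre- and post-processing inside a bounded-error quantum computation:
Bernstein–Vazirani 1997, §8; Nielsen–Chuang 2010, §3.2.5, §4.4). The construction *reuses* the
toolkits `RevGadgets.lean` (`clEval`, `clToggle`), `RevUncompute.lean` (`copyOps`, the fan-out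
layer; the clean block) and `RevMultiplex.lean` (`RevMux.swapOps`, the one-hot length flags
`RevMux.flagOps`, the flag-controlled chunks `RevMux.muxChunk`); this file only adds the two
shapes those do not cover:

* **fan-in**: `xorInto srcs t` is the fan-out layer `copyOps` with *one* target `t` and many
  sources, so `copyOps`' distinct-target lemma does not apply; `clEval_xorInto_target`: the
  target is XORed with `listXor` of the sources (`listXor l = l.foldr xor false`, the shape of
  `clToggle`); a layer of fan-ins onto distinct fresh targets, `xorLayer`, computes all of them
  (`clEval_xorLayer_target`, `clEval_xorLayer_of_not_mem`). Used to decode one-hot cell codes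
  (`ClassicalWrapReadout.lean`, planned sequel);
* **the controlled copy in pair format**: `copyGz cur fr gz b` = the chunk
  `RevMux.muxChunk cur (fun k => fr (k / 2)) gz (2b)` (controlled on `cur`, front wire `fr i`
  onto the two zone wires `gz (2i)`, `gz (2i+1)` — bit doubling) followed by
  `CNOT cur (gz (2b+1))` (the delimiter), so that with `cur` on and a clear zone the zone reads
  `dbl y ++ [0, 1]`, the `boolPair` code of the front word `y` (`clEval_copyGz_zone`), and with
  `cur` off nothing happens (`clEval_copyGz_of_off`). This is Bennett's "copy the answer" step
  between a subroutine and its inverse, in the format the post-processing machine parses.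

## References

* M. A. Nielsen, I. L. Chuang, *Quantum Computation and Quantum Information*, CUP 2010,
  §3.2.5 (reversible computation, FANOUT/copy by CNOT, uncomputation), §4.4.
* C. H. Bennett, *Logical reversibility of computation*, IBM J. Res. Develop. 17 (1973), §2
  (not held; restated in Nielsen–Chuang §3.2.5).
* E. Bernstein, U. Vazirani, *Quantum complexity theory*, SIAM J. Comput. 26 (1997), §8.
-/

namespace Literature.Computability.QuantumComplexity

namespace ClassicalWrap

open Function

variable {ι : Type*}

/-! ### XOR of a list of bits -/

/-- The XOR of a list of bits, `l.foldr xor false` (the shape of `clToggle`; named to state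
fan-in semantics — not Mathlib's bitwise `Nat.xor`/`Num.lxor`). [folklore] -/
def listXor (l : List Bool) : Bool := l.foldr Bool.xor false

/-- `listXor [] = 0`. [folklore] -/
@[simp] theorem listXor_nil : listXor [] = false := rfl

/-- `listXor (b :: l) = b ⊕ listXor l`. [folklore] -/
@[simp] theorem listXor_cons (b : Bool) (l : List Bool) : listXor (b :: l) = (b ^^ listXor l) := rfl

/-- Bridge to the inline `foldr` shape used elsewhere in the tree. [folklore] -/
@[simp] theorem foldr_xor_eq_listXor (l : List Bool) : l.foldr Bool.xor false = listXor l := rfl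

/-- A list of `0`s has XOR `0` (cf. `RevSim.foldr_xor_map_eq_false`). [folklore] -/
theorem listXor_eq_false_of_forall {l : List Bool} (h : ∀ b ∈ l, b = false) : listXor l = false := by
  induction l with
  | nil => rfl
  | cons b l ih =>
    rw [listXor_cons, h b (by simp), ih fun b' hb' => h b' (by simp [hb'])]
    rfl

/-- **XOR of indicator bits over a duplicate-free list**: if `f a` is on exactly when `c = a`,
then `listXor (L.map f)` is on iff `c ∈ L` (stated as an `iff`, independently of decidability
instances). [folklore] -/
theorem listXor_map_eq_true_iff {α : Type*} (c : α) (f : α → Bool) (hf : ∀ a, f a = true ↔ c = a) :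
    ∀ (L : List α), L.Nodup → (listXor (L.map f) = true ↔ c ∈ L)
  | [], _ => by simp
  | a :: L, hL => by
    rw [List.nodup_cons] at hL
    have ih := listXor_map_eq_true_iff c f hf L hL.2
    rw [List.map_cons, listXor_cons, List.mem_cons]
    by_cases hca : c = a
    · subst hca
      have h1 : f c = true := (hf c).2 rfl
      have h2 : listXor (L.map f) = false := by
        cases h : listXor (L.map f)
        · rfl
        · exact absurd (ih.1 h) hL.1
      rw [h1, h2]
      simp
    · have h1 : f a = false := by
        cases h : f a
        · rfl
        · exact absurd ((hf a).1 h) hca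
      rw [h1, Bool.false_xor, ih]
      simp [hca]

/-! ### Fan-in: XOR-accumulating a list of wires into one target -/

/-- `CNOT`s from every source wire onto the target `t`: the fan-out layer `copyOps` of
`RevUncompute.lean` with the pairs `(s, t)`, `s ∈ srcs`. [Nielsen–Chuang 2010, §3.2.5]
[cite: NielsenChuang2010, §3.2.5] -/
def xorInto (srcs : List ι) (t : ι) : List (ClOp ι) := copyOps (srcs.map fun s => (s, t))

/-- `xorInto` unfolded to the list of `CNOT`s. [folklore] -/
theorem xorInto_eq_map (srcs : List ι) (t : ι) : xorInto srcs t = srcs.map fun s => ClOp.cnot s t := by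
  simp [xorInto, copyOps, List.map_map, Function.comp_def]

/-- Members of `xorInto`. [folklore] -/
theorem mem_xorInto {srcs : List ι} {t : ι} {op : ClOp ι} :
    op ∈ xorInto srcs t ↔ ∃ s ∈ srcs, op = ClOp.cnot s t := by
  simp [xorInto_eq_map, eq_comm]

/-- `xorInto` is well formed when the target is not a source (`copyOps_wf`). [folklore] -/
theorem xorInto_wf {srcs : List ι} {t : ι} (h : t ∉ srcs) : ∀ op ∈ xorInto srcs t, op.WF :=
  copyOps_wf fun p hp => by
    obtain ⟨s, hs, rfl⟩ := List.mem_map.1 hp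
    intro e
    change s = t at e
    exact h (e ▸ hs)

/-- Every operation of `xorInto` targets `t`. [folklore] -/
theorem target_of_mem_xorInto {srcs : List ι} {t : ι} {op : ClOp ι} (hop : op ∈ xorInto srcs t) :
    op.target = t := by
  obtain ⟨s, -, rfl⟩ := mem_xorInto.1 hop
  rfl

/-- The controls of an operation of `xorInto` are sources. [folklore] -/
theorem controls_of_mem_xorInto {srcs : List ι} {t : ι} {op : ClOp ι} (hop : op ∈ xorInto srcs t)
    {c : ι} (hc : c ∈ op.controls) : c ∈ srcs := by
  obtain ⟨s, hs, rfl⟩ := mem_xorInto.1 hop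
  simp only [ClOp.controls, List.mem_singleton] at hc
  exact hc ▸ hs

variable [DecidableEq ι]

/-- The toggle of `xorInto` on its target is the XOR of the sources. [folklore] -/
theorem clToggle_xorInto_target (srcs : List ι) (t : ι) (w : ι → Bool) :
    clToggle (xorInto srcs t) w t = listXor (srcs.map w) := by
  rw [xorInto_eq_map]
  induction srcs with
  | nil => rfl
  | cons s srcs ih =>
    rw [List.map_cons, clToggle_cons, ih, List.map_cons, listXor_cons]
    simp [ClOp.target, ClOp.guard]

/-- **Fan-in**: the target is XORed with the XOR of the sources (so it *receives* that XOR when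
it starts at `0`). [Nielsen–Chuang 2010, §3.2.5] [cite: NielsenChuang2010, §3.2.5] -/
theorem clEval_xorInto_target {srcs : List ι} {t : ι} (h : t ∉ srcs) (w : ι → Bool) :
    clEval (xorInto srcs t) w t = (w t ^^ listXor (srcs.map w)) := by
  rw [clEval_apply_of_disjoint _ (fun op hop op' hop' hmem => ?_), clToggle_xorInto_target]
  rw [target_of_mem_xorInto hop'] at hmem
  exact h (controls_of_mem_xorInto hop hmem)

/-- The other wires are unchanged (`clEval_copyOps_of_ne`). [folklore] -/
theorem clEval_xorInto_of_ne (srcs : List ι) {t i : ι} (hi : i ≠ t) (w : ι → Bool) :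
    clEval (xorInto srcs t) w i = w i :=
  clEval_copyOps_of_ne _ w fun p hp => by
    obtain ⟨s, -, rfl⟩ := List.mem_map.1 hp
    exact hi.symm

/-! ### A layer of fan-ins onto distinct fresh targets -/

omit [DecidableEq ι] in
/-- For every label `a` of `l`, accumulate the sources `srcs a` into the target `tgt a`.
[Nielsen–Chuang 2010, §3.2.5] [cite: NielsenChuang2010, §3.2.5] -/
def xorLayer {α : Type*} (l : List α) (srcs : α → List ι) (tgt : α → ι) : List (ClOp ι) :=
  l.flatMap fun a => xorInto (srcs a) (tgt a)

section XorLayer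

variable {α : Type*} {l : List α} {srcs : α → List ι} {tgt : α → ι}

omit [DecidableEq ι] in
/-- Members of a layer. [folklore] -/
theorem mem_xorLayer {op : ClOp ι} :
    op ∈ xorLayer l srcs tgt ↔ ∃ a ∈ l, ∃ s ∈ srcs a, op = ClOp.cnot s (tgt a) := by
  simp only [xorLayer, List.mem_flatMap, mem_xorInto]

omit [DecidableEq ι] in
/-- A layer whose targets are never sources is well formed. [folklore] -/
theorem xorLayer_wf (h : ∀ a ∈ l, ∀ a' ∈ l, tgt a' ∉ srcs a) : ∀ op ∈ xorLayer l srcs tgt, op.WF := by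
  intro op hop
  obtain ⟨a, ha, s, hs, rfl⟩ := mem_xorLayer.1 hop
  exact fun e => h a ha a ha (e ▸ hs)

omit [DecidableEq ι] in
/-- The wires of a layer: targets and sources. [folklore] -/
theorem wiresOf_xorLayer {op : ClOp ι} (hop : op ∈ xorLayer l srcs tgt) {i : ι} (hi : i ∈ RevSim.wiresOf op) :
    ∃ a ∈ l, i = tgt a ∨ i ∈ srcs a := by
  obtain ⟨a, ha, s, hs, rfl⟩ := mem_xorLayer.1 hop
  simp only [RevSim.mem_wiresOf, ClOp.target, ClOp.controls, List.mem_singleton] at hi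
  rcases hi with rfl | rfl
  · exact ⟨a, ha, Or.inl rfl⟩
  · exact ⟨a, ha, Or.inr hs⟩

omit [DecidableEq ι] in
/-- In a layer whose targets are never sources, no target is a control. [folklore] -/
theorem xorLayer_disjoint (h : ∀ a ∈ l, ∀ a' ∈ l, tgt a' ∉ srcs a) :
    ∀ op ∈ xorLayer l srcs tgt, ∀ op' ∈ xorLayer l srcs tgt, op'.target ∉ op.controls := by
  intro op hop op' hop' hmem
  obtain ⟨a, ha, s, hs, rfl⟩ := mem_xorLayer.1 hop
  obtain ⟨a', ha', s', -, rfl⟩ := mem_xorLayer.1 hop'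
  simp only [ClOp.target, ClOp.controls, List.mem_singleton] at hmem
  exact h a ha a' ha' (hmem ▸ hs)

/-- **Each target of the layer is XORed with the XOR of its sources** (targets pairwise
distinct and never sources). [Nielsen–Chuang 2010, §3.2.5] [cite: NielsenChuang2010, §3.2.5] -/
theorem clEval_xorLayer_target (hl : l.Nodup) (hinj : ∀ a ∈ l, ∀ a' ∈ l, tgt a = tgt a' → a = a')
    (h : ∀ a ∈ l, ∀ a' ∈ l, tgt a' ∉ srcs a) (w : ι → Bool) {a : α} (ha : a ∈ l) :
    clEval (xorLayer l srcs tgt) w (tgt a) = (w (tgt a) ^^ listXor ((srcs a).map w)) := by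
  rw [clEval_apply_of_disjoint _ (xorLayer_disjoint h), xorLayer,
    clToggle_flatMap_of_forall_ne l _ w (tgt a) a hl ha (fun a' ha' hne op hop e => ?_),
    clToggle_xorInto_target]
  exact hne (hinj a' ha' a ha ((target_of_mem_xorInto hop).symm.trans e))

/-- Wires that are not targets of the layer are unchanged. [folklore] -/
theorem clEval_xorLayer_of_not_mem (w : ι → Bool) {i : ι} (hi : ∀ a ∈ l, tgt a ≠ i) :
    clEval (xorLayer l srcs tgt) w i = w i :=
  clEval_apply_of_forall_target_ne _ _ fun op hop => by
    obtain ⟨a, ha, s, -, rfl⟩ := mem_xorLayer.1 hop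
    exact hi a ha

end XorLayer

/-! ### The controlled copy of the front in pair format -/

omit [DecidableEq ι] in
/-- **Controlled copy of the front in `boolPair` format.** Controlled on the wire `cur`: the
chunk `RevMux.muxChunk cur (fun k => fr (k / 2)) gz (2b)` writes front wire `fr i`, `i < b`,
onto the two zone wires `gz (2i)`, `gz (2i+1)` (bit doubling), and a final `CNOT` sets the
delimiter `gz (2b+1)`. [Nielsen–Chuang 2010, §3.2.5 (copy by CNOT/Toffoli); Bennett 1973, §2]
[cite: NielsenChuang2010, §3.2.5] -/
def copyGz (cur : ι) (fr gz : ℕ → ι) (b : ℕ) : List (ClOp ι) :=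
  RevMux.muxChunk cur (fun k => fr (k / 2)) gz (2 * b) ++ [ClOp.cnot cur (gz (2 * b + 1))]

section Copy

variable {cur : ι} {fr gz : ℕ → ι} {b : ℕ}

omit [DecidableEq ι] in
/-- Members of the copy gadget. [folklore] -/
theorem mem_copyGz {op : ClOp ι} :
    op ∈ copyGz cur fr gz b ↔ (∃ k < 2 * b, op = ClOp.toffoli cur (fr (k / 2)) (gz k)) ∨ op = ClOp.cnot cur (gz (2 * b + 1)) := by
  simp only [copyGz, List.mem_append, RevMux.mem_muxChunk, List.mem_singleton]

omit [DecidableEq ι] in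
/-- Targets of the copy gadget are zone wires `gz k`, `k < 2b` or `k = 2b + 1`. [folklore] -/
theorem target_of_mem_copyGz {op : ClOp ι} (hop : op ∈ copyGz cur fr gz b) :
    ∃ k, (k < 2 * b ∨ k = 2 * b + 1) ∧ op.target = gz k := by
  rcases mem_copyGz.1 hop with ⟨k, hk, rfl⟩ | rfl
  · exact ⟨k, Or.inl hk, rfl⟩
  · exact ⟨2 * b + 1, Or.inr rfl, rfl⟩

omit [DecidableEq ι] in
/-- Controls of the copy gadget are `cur` and front wires `fr i`, `i < b`. [folklore] -/
theorem controls_of_mem_copyGz {op : ClOp ι} (hop : op ∈ copyGz cur fr gz b) {c : ι} (hc : c ∈ op.controls) :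
    c = cur ∨ ∃ i < b, c = fr i := by
  rcases mem_copyGz.1 hop with ⟨k, hk, rfl⟩ | rfl
  · simp only [ClOp.controls, List.mem_cons, List.not_mem_nil, or_false] at hc
    rcases hc with rfl | rfl
    · exact Or.inl rfl
    · exact Or.inr ⟨k / 2, by omega, rfl⟩
  · simp only [ClOp.controls, List.mem_singleton] at hc
    exact Or.inl hc

/-- Hypotheses making the copy gadget a fresh-target gadget: the zone wires are pairwise
distinct and distinct from `cur` and from the front. [folklore] -/
structure CopyFresh (cur : ι) (fr gz : ℕ → ι) (b : ℕ) : Prop where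
  /-- zone wires are injective -/
  gz_inj : ∀ k ≤ 2 * b + 1, ∀ k' ≤ 2 * b + 1, gz k = gz k' → k = k'
  /-- zone wires are not the control -/
  gz_ne_cur : ∀ k ≤ 2 * b + 1, gz k ≠ cur
  /-- zone wires are not front wires -/
  gz_ne_fr : ∀ k ≤ 2 * b + 1, ∀ i < b, gz k ≠ fr i
  /-- the control is not a front wire -/
  cur_ne_fr : ∀ i < b, cur ≠ fr i

omit [DecidableEq ι] in
/-- The copy gadget is well formed. [folklore] -/
theorem copyGz_wf (hf : CopyFresh cur fr gz b) : ∀ op ∈ copyGz cur fr gz b, op.WF := by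
  intro op hop
  rcases mem_copyGz.1 hop with ⟨k, hk, rfl⟩ | rfl
  · exact ⟨hf.cur_ne_fr _ (by omega), (hf.gz_ne_cur k (by omega)).symm, (hf.gz_ne_fr k (by omega) _ (by omega)).symm⟩
  · exact (hf.gz_ne_cur _ le_rfl).symm

omit [DecidableEq ι] in
/-- No target of the copy gadget is a control. [folklore] -/
theorem copyGz_disjoint (hf : CopyFresh cur fr gz b) :
    ∀ op ∈ copyGz cur fr gz b, ∀ op' ∈ copyGz cur fr gz b, op'.target ∉ op.controls := by
  intro op hop op' hop' hmem
  obtain ⟨k, hk, hk'⟩ := target_of_mem_copyGz hop'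
  rw [hk'] at hmem
  rcases controls_of_mem_copyGz hop hmem with h | ⟨i, hi, h⟩
  · exact hf.gz_ne_cur k (by omega) h
  · exact hf.gz_ne_fr k (by omega) i hi h

/-- **Control off: the copy gadget is the identity.** [folklore] -/
theorem clEval_copyGz_of_off (hf : CopyFresh cur fr gz b) (w : ι → Bool) (hw : w cur = false) :
    clEval (copyGz cur fr gz b) w = w := by
  refine clEval_eq_self_of_guard _ (copyGz_disjoint hf) w fun op hop => ?_
  rcases mem_copyGz.1 hop with ⟨k, hk, rfl⟩ | rfl <;> simp [ClOp.guard, hw]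

/-- **Control on**: zone wire `gz k`, `k < 2b`, is XORed with the front bit `fr (k/2)`, the
delimiter wire `gz (2b+1)` is flipped, and nothing else changes. [Nielsen–Chuang 2010, §3.2.5]
[cite: NielsenChuang2010, §3.2.5] -/
theorem clEval_copyGz_of_on (hf : CopyFresh cur fr gz b) (w : ι → Bool) (hw : w cur = true) :
    (∀ k < 2 * b, clEval (copyGz cur fr gz b) w (gz k) = (w (gz k) ^^ w (fr (k / 2)))) ∧
    clEval (copyGz cur fr gz b) w (gz (2 * b + 1)) = !w (gz (2 * b + 1)) ∧
    (∀ j, (∀ k, k < 2 * b ∨ k = 2 * b + 1 → gz k ≠ j) → clEval (copyGz cur fr gz b) w j = w j) := by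
  have hev : ∀ j, clEval (copyGz cur fr gz b) w j =
      (w j ^^ (clToggle (RevMux.muxChunk cur (fun k => fr (k / 2)) gz (2 * b)) w j ^^
        (decide (gz (2 * b + 1) = j) && w cur))) := by
    intro j
    rw [clEval_apply_of_disjoint _ (copyGz_disjoint hf), copyGz, clToggle_append, clToggle_cons, clToggle_nil,
      Bool.xor_false]
    rfl
  refine ⟨fun k hk => ?_, ?_, fun j hj => ?_⟩
  · rw [hev, RevMux.clToggle_muxChunk_dst w hw (fun i hi i' hi' h => hf.gz_inj i (by omega) i' (by omega) h) hk]
    have hne : gz (2 * b + 1) ≠ gz k := fun h => by have := hf.gz_inj _ le_rfl k (by omega) h; omega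
    simp [hne]
  · rw [hev, RevMux.clToggle_muxChunk_of_forall_ne w (fun i hi h => ?_), hw]
    · simp
    · have := hf.gz_inj i (by omega) _ le_rfl h; omega
  · rw [hev, RevMux.clToggle_muxChunk_of_forall_ne w (fun i hi => hj i (Or.inl hi))]
    simp [hj (2 * b + 1) (Or.inr rfl)]

/-- **With `cur` on and a clear zone, the zone holds the front word in pair format**: wire
`gz (2i)` and `gz (2i+1)` hold `w (fr i)` (`i < b`), `gz (2b)` holds `0`, `gz (2b+1)` holds
`1`, and wires off the zone are unchanged. [folklore] -/
theorem clEval_copyGz_zone (hf : CopyFresh cur fr gz b) (w : ι → Bool) (hw : w cur = true)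
    (hzero : ∀ k ≤ 2 * b + 1, w (gz k) = false) :
    (∀ i < b, clEval (copyGz cur fr gz b) w (gz (2 * i)) = w (fr i) ∧
      clEval (copyGz cur fr gz b) w (gz (2 * i + 1)) = w (fr i)) ∧
    clEval (copyGz cur fr gz b) w (gz (2 * b)) = false ∧
    clEval (copyGz cur fr gz b) w (gz (2 * b + 1)) = true ∧
    (∀ j, (∀ k ≤ 2 * b + 1, gz k ≠ j) → clEval (copyGz cur fr gz b) w j = w j) := by
  obtain ⟨h1, h2, h3⟩ := clEval_copyGz_of_on hf w hw
  refine ⟨fun i hi => ⟨?_, ?_⟩, ?_, ?_, fun j hj => h3 j fun k hk => hj k (by omega)⟩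
  · rw [h1 _ (by omega), hzero _ (by omega), Bool.false_xor]
    congr 2
    omega
  · rw [h1 _ (by omega), hzero _ (by omega), Bool.false_xor]
    congr 2
    omega
  · rw [h3 _ (fun k hk h => ?_), hzero _ (by omega)]
    have := hf.gz_inj k (by omega) (2 * b) (by omega) h
    omega
  · rw [h2, hzero _ le_rfl]
    rfl

omit [DecidableEq ι] in
/-- The wires of the copy gadget. [folklore] -/
theorem wiresOf_copyGz {op : ClOp ι} (hop : op ∈ copyGz cur fr gz b) {i : ι} (hi : i ∈ RevSim.wiresOf op) :
    i = cur ∨ (∃ j < b, i = fr j) ∨ ∃ k ≤ 2 * b + 1, i = gz k := by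
  rw [RevSim.mem_wiresOf] at hi
  rcases hi with rfl | hi
  · obtain ⟨k, hk, hk'⟩ := target_of_mem_copyGz hop
    exact Or.inr (Or.inr ⟨k, by omega, hk'⟩)
  · rcases controls_of_mem_copyGz hop hi with h | h
    · exact Or.inl h
    · exact Or.inr (Or.inl h)

end Copy

end ClassicalWrap

end Literature.Computability.QuantumComplexity
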